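import Mathlib
import HarnessLib
import Literature.Analysis.FluidPDE.VectorCalculus
import Literature.Analysis.FluidPDE.Seregin2020SwirlEnergyInequality
import Summits.NavierStokesRegularity.NavierStokesRegularity.Theorems.UnthreadedDoorAntidynamoLambAlgebra
import Summits.NavierStokesRegularity.NavierStokesRegularity.Theorems.UnthreadedDoorAntidynamoChunkVorticity
import Summits.NavierStokesRegularity.NavierStokesRegularity.Theorems.UnthreadedDoorAntidynamoRadialGradientUnthreaded

/-!
# Route `UnthreadedDoor` / `ThreadingFlux`, crux `PoloidalLiouville` (stmt-NavierStokesRegularity-1222), antidynamo v2 skeleton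
# (sha16 `4ebf5683127b`), rung `stub_singleDegreeRung`, EVEN degree — input (E2), radial form: `curl (V × ω)` ON THE TOROIDAL SLOTS

Support file (seat leafhand-ns-unthreadeddoor-1 g1, cell decomp-ns), `--supports stmt-NavierStokesRegularity-1222 --as helper`; theorems only.
Continuation of `…AntidynamoLambAlgebra.curl_lamb_eq`: with the Euler identity `⟪∇P(z), z⟫ = l P(z)` of the homogeneous profile the two
gradients are a radial function times `P`, resp. radial functions times `P²` and `|∇P|²`, and their radial parts drop out of the cross
products.  Result (`curl_lamb_eq_radial`), for `V = (a(r)P) • y + k(r) • ∇P`, `ω = G(r) • (∇P × y)`, `r = ‖y‖ ≠ 0`: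

  `curl (V × ω)(y) = −(B′(r) P(y)/r + 2 l G(r) a(r) P(y)) • (∇P(y) × y) − (G(r) k(r)) • (∇|∇P|²(y) × y)`,  `B(r) = G(r)(a(r) r² + l k(r))`,

— the identity (E2) of the even-degree repair census (RUNG-PARITY-LEAFHAND-g1.md): the vorticity equation for the single-degree ansatz reads
`∇Ψ × y = 0` with `Ψ = −½(B′/r + 2laG) P² − G k |∇P|² − F P`, `F = G_t − G″ − (2l+2)G′/r`.

Gradient plumbing recorded on the way: `gradient_fun_add'` (the product rule is the tree's `Seregin2020.gradient_mul_apply'`), `gradient_radial` (`∇(B ∘ ‖·‖)(z) = (B′(‖z‖)/‖z‖) • z`),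
`gradient_radial_mul` (`∇(B(‖·‖) P)(z) = B(‖z‖) • ∇P(z) + (P(z) B′(‖z‖)/‖z‖) • z`).

HONEST LABEL: calculus input for the open even-degree rung; nothing here proves the rung, the wall, `PoloidalLiouville` (1222), or bears on
Navier–Stokes regularity. [folklore]
-/

noncomputable section

-- the summit and its single sub-problem share the name (CONVENTIONS §1)
set_option linter.dupNamespace false

open scoped Topology InnerProductSpace RealInnerProductSpace ContDiff
open Filter Set Function Metric
open Literature.Analysis.FluidPDE

namespace Summit.NavierStokesRegularity.NavierStokesRegularity.Theorems.PoloidalLiouville.Antidynamo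

/-- `∇(f + g) = ∇f + ∇g` at a point of differentiability. [folklore] -/
theorem gradient_fun_add' {f g : EuclideanSpace ℝ (Fin 3) → ℝ} {z : EuclideanSpace ℝ (Fin 3)}
    (hf : DifferentiableAt ℝ f z) (hg : DifferentiableAt ℝ g z) :
    gradient (fun y => f y + g y) z = gradient f z + gradient g z := by
  rw [gradient, gradient, gradient, fderiv_fun_add hf hg, map_add]

/-- **Gradient of a radial function**: `∇(B ∘ ‖·‖)(z) = (B′(‖z‖)/‖z‖) • z` for `z ≠ 0`, `B` differentiable at `‖z‖`. [folklore] -/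
theorem gradient_radial {B : ℝ → ℝ} {z : EuclideanSpace ℝ (Fin 3)} (hz : z ≠ 0) (hB : DifferentiableAt ℝ B ‖z‖) :
    gradient (fun y : EuclideanSpace ℝ (Fin 3) => B ‖y‖) z = (deriv B ‖z‖ / ‖z‖) • z := by
  have hn := hasFDerivAt_norm_smul_innerSL hz
  have h : HasFDerivAt (fun y : EuclideanSpace ℝ (Fin 3) => B ‖y‖)
      (deriv B ‖z‖ • (deriv Real.sqrt (‖z‖ ^ 2) * 2) • innerSL ℝ z) z := hB.hasDerivAt.comp_hasFDerivAt z hn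
  rw [gradient, h.fderiv, smul_smul, toDual_symm_smul_innerSL]
  congr 1
  have ht0 : ‖z‖ ^ 2 ≠ 0 := pow_ne_zero _ (norm_ne_zero_iff.2 hz)
  rw [(Real.hasDerivAt_sqrt ht0).deriv, Real.sqrt_sq (norm_nonneg z)]
  field_simp

/-- **Gradient of a radial function times a scalar field**: `∇(B(‖·‖) P)(z) = B(‖z‖) • ∇P(z) + (P(z) B′(‖z‖)/‖z‖) • z`. [folklore] -/
theorem gradient_radial_mul {B : ℝ → ℝ} {P : EuclideanSpace ℝ (Fin 3) → ℝ} {z : EuclideanSpace ℝ (Fin 3)} (hz : z ≠ 0)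
    (hB : DifferentiableAt ℝ B ‖z‖) (hP : DifferentiableAt ℝ P z) :
    gradient (fun y : EuclideanSpace ℝ (Fin 3) => B ‖y‖ * P y) z =
      B ‖z‖ • gradient P z + (P z * deriv B ‖z‖ / ‖z‖) • z := by
  have hBn : DifferentiableAt ℝ (fun y : EuclideanSpace ℝ (Fin 3) => B ‖y‖) z :=
    hB.comp z ((contDiffAt_norm ℝ hz (n := 1)).differentiableAt (by simp))
  rw [Literature.Analysis.FluidPDE.Seregin2020.gradient_mul_apply' hBn hP, gradient_radial hz hB, smul_smul, mul_div_assoc]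

/-- ★ **CURL OF THE SINGLE-DEGREE LAMB VECTOR, RADIAL FORM (E2).**  With `V z = (a ‖z‖ * P z) • z + k ‖z‖ • ∇P z`,
`ω z = G ‖z‖ • (∇P z × z)`, `P ∈ C²` satisfying the Euler identity `⟪∇P z, z⟫ = l P z` (homogeneous of degree `l`), and `a, k, G`
differentiable at `‖x‖`, `x ≠ 0`:
`curl (V × ω)(x) = −(B′(‖x‖) P(x)/‖x‖ + 2 l G a P(x)) • (∇P(x) × x) − (G k) • (∇|∇P|²(x) × x)`, `B(r) = G(r)(a(r) r² + l k(r))`. [folklore] -/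
theorem curl_lamb_eq_radial {a k G : ℝ → ℝ} {P : EuclideanSpace ℝ (Fin 3) → ℝ} (hP : ContDiff ℝ 2 P) {l : ℝ}
    (hEuler : ∀ z : EuclideanSpace ℝ (Fin 3), ⟪gradient P z, z⟫ = l * P z)
    {x : EuclideanSpace ℝ (Fin 3)} (hx : x ≠ 0) (ha : DifferentiableAt ℝ a ‖x‖) (hk : DifferentiableAt ℝ k ‖x‖)
    (hG : DifferentiableAt ℝ G ‖x‖) :
    curl (fun z : EuclideanSpace ℝ (Fin 3) =>
        cross ((a ‖z‖ * P z) • z + k ‖z‖ • gradient P z) (G ‖z‖ • cross (gradient P z) z)) x =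
      -((P x * deriv (fun r => G r * (a r * r ^ 2 + l * k r)) ‖x‖ / ‖x‖ + 2 * l * G ‖x‖ * a ‖x‖ * P x) •
          cross (gradient P x) x) -
        (G ‖x‖ * k ‖x‖) • cross (gradient (fun z => ⟪gradient P z, gradient P z⟫) x) x := by
  rw [curl_lamb_eq hP hx ha hk hG]
  set B : ℝ → ℝ := fun r => G r * (a r * r ^ 2 + l * k r) with hBdef
  -- the first coefficient is `B(‖z‖) * P z`
  have hβ : (fun z : EuclideanSpace ℝ (Fin 3) => G ‖z‖ * (a ‖z‖ * P z * ⟪z, z⟫ + k ‖z‖ * ⟪gradient P z, z⟫)) =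
      fun z => B ‖z‖ * P z := by
    funext z
    rw [hEuler z, real_inner_self_eq_norm_sq, hBdef]
    ring
  -- the second coefficient is `(G a l)(‖z‖) * (P z * P z) + (G k)(‖z‖) * |∇P z|²`
  have hh : (fun z : EuclideanSpace ℝ (Fin 3) =>
      G ‖z‖ * (a ‖z‖ * P z * ⟪gradient P z, z⟫ + k ‖z‖ * ⟪gradient P z, gradient P z⟫)) =
      fun z => (G ‖z‖ * a ‖z‖ * l) * (P z * P z) + (G ‖z‖ * k ‖z‖) * ⟪gradient P z, gradient P z⟫ := by
    funext z
    rw [hEuler z]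
    ring
  rw [hβ, hh]
  -- differentiability facts at `x`
  have hn : DifferentiableAt ℝ (fun z : EuclideanSpace ℝ (Fin 3) => ‖z‖) x :=
    (contDiffAt_norm ℝ hx (n := 1)).differentiableAt (by simp)
  have hPd : DifferentiableAt ℝ P x := (hP.differentiable (by norm_num)) x
  have hgP : DifferentiableAt ℝ (gradient P) x := (differentiable_gradient_of_contDiff_two hP) x
  have hB : DifferentiableAt ℝ B ‖x‖ := by
    rw [hBdef]
    exact hG.mul ((ha.mul (differentiableAt_id.pow 2)).add ((differentiableAt_const _).mul hk))
  have hGal : DifferentiableAt ℝ (fun r => G r * a r * l) ‖x‖ := (hG.mul ha).mul (differentiableAt_const _)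
  have hGk : DifferentiableAt ℝ (fun r => G r * k r) ‖x‖ := hG.mul hk
  have hPP : DifferentiableAt ℝ (fun z : EuclideanSpace ℝ (Fin 3) => P z * P z) x := hPd.mul hPd
  have hgg : DifferentiableAt ℝ (fun z : EuclideanSpace ℝ (Fin 3) => ⟪gradient P z, gradient P z⟫) x := hgP.inner ℝ hgP
  have h1 : DifferentiableAt ℝ (fun z : EuclideanSpace ℝ (Fin 3) => (G ‖z‖ * a ‖z‖ * l) * (P z * P z)) x :=
    (hGal.comp x hn).mul hPP
  have h2 : DifferentiableAt ℝ (fun z : EuclideanSpace ℝ (Fin 3) => (G ‖z‖ * k ‖z‖) * ⟪gradient P z, gradient P z⟫) x :=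
    (hGk.comp x hn).mul hgg
  -- first slot: `∇(B P) × ∇P = (P B′/r) • (x × ∇P) = −(P B′/r) • (∇P × x)`
  have hfirst : cross (gradient (fun z : EuclideanSpace ℝ (Fin 3) => B ‖z‖ * P z) x) (gradient P x) =
      -((P x * deriv B ‖x‖ / ‖x‖) • cross (gradient P x) x) := by
    rw [gradient_radial_mul hx hB hPd, ← crossCLM_apply, map_add, map_smul, map_smul]
    simp only [_root_.add_apply, _root_.smul_apply, crossCLM_apply]
    have h0 : cross (gradient P x) (gradient P x) = 0 := by simpa using cross_smul_self_left 1 (gradient P x)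
    rw [h0, smul_zero, zero_add, cross_swap x (gradient P x), smul_neg]
  -- second slot: the radial factors drop out (`cross_gradient_radialMul`), `∇(P²) = 2P ∇P`
  have hsecond : cross (gradient (fun z : EuclideanSpace ℝ (Fin 3) =>
      (G ‖z‖ * a ‖z‖ * l) * (P z * P z) + (G ‖z‖ * k ‖z‖) * ⟪gradient P z, gradient P z⟫) x) x =
      (2 * l * G ‖x‖ * a ‖x‖ * P x) • cross (gradient P x) x +
        (G ‖x‖ * k ‖x‖) • cross (gradient (fun z => ⟪gradient P z, gradient P z⟫) x) x := by
    rw [gradient_fun_add' h1 h2, ← crossCLM_apply, map_add]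
    simp only [_root_.add_apply, crossCLM_apply]
    rw [cross_gradient_radialMul (ĝ := fun r => G r * a r * l) hx hGal hPP,
      cross_gradient_radialMul (ĝ := fun r => G r * k r) hx hGk hgg, Literature.Analysis.FluidPDE.Seregin2020.gradient_mul_apply' hPd hPd, ← two_smul ℝ,
      smul_smul, ← crossCLM_apply, map_smul, _root_.smul_apply, crossCLM_apply, smul_smul]
    congr 1
    ring
  rw [hfirst, hsecond]
  simp only [hBdef]
  rw [add_smul, neg_add]
  abel

end Summit.NavierStokesRegularity.NavierStokesRegularity.Theorems.PoloidalLiouville.Antidynamo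

end
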